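import Summits.BirchSwinnertonDyer.Rank1Residual.Additive.ThreeTorsionFullCubeDisc
import Summits.BirchSwinnertonDyer.Rank1Residual.Additive.WildThreeResidualShape
import Summits.BirchSwinnertonDyer.BirchSwinnertonDyer.Theorems.CyclotomicUntwistCoefficientField
import HarnessLib

/-!
# At most TWO `G_{ℚ₃}`-stable lines: `Ψ₃` has at most two roots in any field without a primitive
# cube root of unity (route `CyclotomicUntwist` seat `bsd-line-cycu-p2` g5, O6 lane V10; THEOREMS ONLY)

The census column `nroots = numStableLinesAtThree W ∈ {0, 1, 2}` (o6-r1 V10: IRR / one line / SPLIT)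
silently uses that `Ψ₃` never has three or four roots in `ℚ₃`. Kernel form, over any field `K` with
`2, 3 ≠ 0` and NO primitive cube root of unity (`∀ z, z² + z + 1 ≠ 0`), for an elliptic curve `V/K`:

* `false_of_Ψ₃_eq_prod` — a complete factorisation `Ψ₃ = 3∏(X − xᵢ)` with `x₁ ≠ x₄`, `x₂ ≠ x₃` is
  impossible: by n1011's resolvent identity `c₄_sub_nine_mul_sq_pow_three_eq`
  (`(c₄ − 9(x₁+x₂−x₃−x₄)²)³ = 1728Δ`, and the same with `x₂ ↔ x₃`) the two resolvents are DISTINCT cube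
  roots of `1728Δ ≠ 0` (their difference is `36(x₁ − x₄)(x₂ − x₃)`), so their ratio is a primitive
  cube root of unity;
* `false_of_three_roots_Ψ₃` — three distinct `K`-roots already force such a factorisation (divide out
  the three linear factors; the cofactor is `3(X − x₄)`, and `x₄` differs from two of the three);
* `ℚ₃` has no primitive cube root of unity (tree: `PSCoefficientField.sq_add_self_add_one_ne_zero`);
  (`(2z+1)² = −3` has odd valuation);
* **`numStableLinesAtThree_le_two`** — for EVERY elliptic `W/ℚ`, `O5.numStableLinesAtThree W ≤ 2`
  (`W[3]|G_{ℚ₃}` is never scalar), and `numStableLinesAtThree_eq_two_of_shapeSplitThree`.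

HONEST FRAMING: helper theorems; nothing about any particular curve is asserted; BSD is not proved for
any curve. References: [SilvermanAEC2009] III.1, Exercise 3.7; [Serre1972] §1.11.
-/

set_option linter.dupNamespace false

noncomputable section

open scoped Classical

namespace Summit.BirchSwinnertonDyer.BirchSwinnertonDyer.Theorems.CompanionShape

open Polynomial WeierstrassCurve Literature.NumberTheory.EllipticCurves
  Summit.BirchSwinnertonDyer.Rank1Residual.Additive Summit.BirchSwinnertonDyer.Rank1Residual

/-! ## §1 No complete factorisation of `Ψ₃` without a cube root of unity -/

section Field

variable {K : Type*} [Field K] (V : WeierstrassCurve K) [V.IsElliptic]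

/-- **Four roots need `ζ₃`.** Over a field with `2, 3 ≠ 0` and no primitive cube root of unity, a
factorisation `Ψ₃ = 3 (X − x₁)(X − x₂)(X − x₃)(X − x₄)` with `x₁ ≠ x₄`, `x₂ ≠ x₃` is impossible: the
resolvents `c₄ − 9(x₁ + x₂ − x₃ − x₄)²` and `c₄ − 9(x₁ + x₃ − x₂ − x₄)²` are distinct cube roots of
`1728Δ ≠ 0`. [cite: SilvermanAEC2009, III.1 and Exercise 3.7] -/
theorem false_of_Ψ₃_eq_prod (h2 : (2 : K) ≠ 0) (h3 : (3 : K) ≠ 0) (hζ : ∀ z : K, z ^ 2 + z + 1 ≠ 0)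
    {x₁ x₂ x₃ x₄ : K} (h14 : x₁ ≠ x₄) (h23 : x₂ ≠ x₃)
    (hΨ : V.Ψ₃ = C 3 * ((X - C x₁) * (X - C x₂) * (X - C x₃) * (X - C x₄))) : False := by
  have hΨ' : V.Ψ₃ = C 3 * ((X - C x₁) * (X - C x₃) * (X - C x₂) * (X - C x₄)) := by rw [hΨ]; ring
  set A := V.c₄ - 9 * (x₁ + x₂ - x₃ - x₄) ^ 2 with hA
  set B := V.c₄ - 9 * (x₁ + x₃ - x₂ - x₄) ^ 2 with hB
  have hA3 : A ^ 3 = 1728 * V.Δ := c₄_sub_nine_mul_sq_pow_three_eq V h3 hΨ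
  have hB3 : B ^ 3 = 1728 * V.Δ := c₄_sub_nine_mul_sq_pow_three_eq V h3 hΨ'
  have hΔ : V.Δ ≠ 0 := V.coe_Δ' ▸ V.Δ'.ne_zero
  have h1728 : (1728 : K) ≠ 0 := by
    rw [show (1728 : K) = 2 ^ 6 * 3 ^ 3 by norm_num]
    exact mul_ne_zero (pow_ne_zero 6 h2) (pow_ne_zero 3 h3)
  have hA0 : A ≠ 0 := fun h0 ↦ by
    rw [h0, zero_pow three_ne_zero] at hA3
    exact mul_ne_zero h1728 hΔ hA3.symm
  have hAB : A ≠ B := by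
    intro h
    have : (36 : K) * ((x₂ - x₃) * (x₁ - x₄)) = 0 := by
      have e : A - B = -(36 : K) * ((x₂ - x₃) * (x₁ - x₄)) := by rw [hA, hB]; ring
      have : A - B = 0 := sub_eq_zero.mpr h
      linear_combination e - this
    have h36 : (36 : K) ≠ 0 := by
      rw [show (36 : K) = 2 ^ 2 * 3 ^ 2 by norm_num]
      exact mul_ne_zero (pow_ne_zero 2 h2) (pow_ne_zero 2 h3)
    rcases mul_eq_zero.mp this with h | h
    · exact h36 h
    · rcases mul_eq_zero.mp h with h | h
      · exact h23 (sub_eq_zero.mp h)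
      · exact h14 (sub_eq_zero.mp h)
  -- `u = B/A` is a primitive cube root of unity
  set u := B / A with hu
  have hu3 : u ^ 3 = 1 := by
    rw [hu, div_pow, hB3, hA3, div_self (mul_ne_zero h1728 hΔ)]
  have hu1 : u ≠ 1 := fun h ↦ hAB (by rw [hu, div_eq_one_iff_eq hA0] at h; exact h.symm)
  have key : (u - 1) * (u ^ 2 + u + 1) = 0 := by linear_combination hu3
  rcases mul_eq_zero.mp key with h | h
  · exact hu1 (sub_eq_zero.mp h)
  · exact hζ u h

/-- **Three distinct roots of `Ψ₃` are impossible** without a primitive cube root of unity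
(`2, 3 ≠ 0`): dividing out `(X − r₁)(X − r₂)(X − r₃)` leaves `3(X − r₄)`, and `r₄` differs from two
of `r₁, r₂, r₃`. [cite: SilvermanAEC2009, Exercise 3.7] -/
theorem false_of_three_roots_Ψ₃ (h2 : (2 : K) ≠ 0) (h3 : (3 : K) ≠ 0)
    (hζ : ∀ z : K, z ^ 2 + z + 1 ≠ 0) {r₁ r₂ r₃ : K} (h12 : r₁ ≠ r₂) (h13 : r₁ ≠ r₃) (h23 : r₂ ≠ r₃)
    (hr₁ : V.Ψ₃.IsRoot r₁) (hr₂ : V.Ψ₃.IsRoot r₂) (hr₃ : V.Ψ₃.IsRoot r₃) : False := by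
  set p := V.Ψ₃ with hp
  have hp0 : p ≠ 0 := Ψ₃_ne_zero V h3
  have hdeg : p.natDegree = 4 := V.natDegree_Ψ₃ h3
  have hlc : p.leadingCoeff = 3 := V.leadingCoeff_Ψ₃ h3
  -- divide out the three roots
  set p₁ := p / (X - C r₁) with hp₁
  have e₁ : (X - C r₁) * p₁ = p := mul_div_eq_iff_isRoot.mpr hr₁
  have hp₁0 : p₁ ≠ 0 := fun h ↦ hp0 (by rw [← e₁, h, mul_zero])
  have hr₂' : p₁.IsRoot r₂ := by
    have := hr₂.eq_zero
    rw [← e₁, eval_mul, eval_sub, eval_X, eval_C, mul_eq_zero] at this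
    exact this.resolve_left (sub_ne_zero.mpr h12.symm)
  set p₂ := p₁ / (X - C r₂) with hp₂
  have e₂ : (X - C r₂) * p₂ = p₁ := mul_div_eq_iff_isRoot.mpr hr₂'
  have hp₂0 : p₂ ≠ 0 := fun h ↦ hp₁0 (by rw [← e₂, h, mul_zero])
  have hr₃' : p₂.IsRoot r₃ := by
    have := hr₃.eq_zero
    rw [← e₁, ← e₂, eval_mul, eval_mul, eval_sub, eval_sub, eval_X, eval_C, eval_C, mul_eq_zero,
      mul_eq_zero] at this
    rcases this with h | h | h
    · exact absurd (sub_eq_zero.mp h) h13.symm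
    · exact absurd (sub_eq_zero.mp h) h23.symm
    · exact h
  set p₃ := p₂ / (X - C r₃) with hp₃
  have e₃ : (X - C r₃) * p₃ = p₂ := mul_div_eq_iff_isRoot.mpr hr₃'
  have hp₃0 : p₃ ≠ 0 := fun h ↦ hp₂0 (by rw [← e₃, h, mul_zero])
  -- the cofactor is linear with leading coefficient `3`
  have hXr : ∀ r : K, (X - C r) ≠ 0 := fun r ↦ X_sub_C_ne_zero r
  have hdeg₃ : p₃.natDegree = 1 := by
    have d₁ : p.natDegree = 1 + p₁.natDegree := by
      rw [← e₁, natDegree_mul (hXr r₁) hp₁0, natDegree_X_sub_C]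
    have d₂ : p₁.natDegree = 1 + p₂.natDegree := by
      rw [← e₂, natDegree_mul (hXr r₂) hp₂0, natDegree_X_sub_C]
    have d₃ : p₂.natDegree = 1 + p₃.natDegree := by
      rw [← e₃, natDegree_mul (hXr r₃) hp₃0, natDegree_X_sub_C]
    omega
  have hlc₃ : p₃.leadingCoeff = 3 := by
    have : p.leadingCoeff = p₃.leadingCoeff := by
      rw [← e₁, ← e₂, ← e₃, leadingCoeff_mul, leadingCoeff_mul, leadingCoeff_mul, leadingCoeff_X_sub_C,
        leadingCoeff_X_sub_C, leadingCoeff_X_sub_C, one_mul, one_mul, one_mul]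
    rw [← this, hlc]
  have hp₃eq : p₃ = C 3 * (X - C (-(p₃.coeff 0) / 3)) := by
    have h := eq_X_add_C_of_natDegree_le_one (le_of_eq hdeg₃)
    have hc1 : p₃.coeff 1 = 3 := by
      rw [← hlc₃, leadingCoeff, hdeg₃]
    have e : C (3 : K) * (X - C (-(p₃.coeff 0) / 3)) = C (3 : K) * X + C (p₃.coeff 0) := by
      have h33 : (3 : K) * (-(p₃.coeff 0) / 3) = -(p₃.coeff 0) := by field_simp
      rw [mul_sub, ← C_mul, h33, C_neg, sub_neg_eq_add]
    calc p₃ = C (p₃.coeff 1) * X + C (p₃.coeff 0) := h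
      _ = C 3 * X + C (p₃.coeff 0) := by rw [hc1]
      _ = C 3 * (X - C (-(p₃.coeff 0) / 3)) := e.symm
  set r₄ := -(p₃.coeff 0) / 3 with hr₄
  have hfac : p = (X - C r₁) * ((X - C r₂) * ((X - C r₃) * (C 3 * (X - C r₄)))) := by
    rw [← hp₃eq, e₃, e₂, e₁]
  -- pair `r₄` with a root it differs from
  by_cases h41 : r₄ = r₁
  · refine false_of_Ψ₃_eq_prod V h2 h3 hζ (x₁ := r₂) (x₂ := r₁) (x₃ := r₃) (x₄ := r₄)
      (fun h ↦ h12 (h41.symm.trans h.symm)) h13 ?_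
    rw [← hp, hfac]; ring
  · refine false_of_Ψ₃_eq_prod V h2 h3 hζ (x₁ := r₁) (x₂ := r₂) (x₃ := r₃) (x₄ := r₄)
      (fun h ↦ h41 h.symm) h23 ?_
    rw [← hp, hfac]; ring

end Field

/-! ## §2 `ℚ₃` has no primitive cube root of unity; at most two stable lines -/

variable (W : WeierstrassCurve ℚ) [W.IsElliptic]

/-- **At most two `G_{ℚ₃}`-stable lines**: `numStableLinesAtThree W ≤ 2` for every elliptic `W/ℚ` —
`Ψ₃` has at most two roots in `ℚ₃` (`W[3]|G_{ℚ₃}` is never scalar). [cite: Serre1972, §1.11]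
[cite: SilvermanAEC2009, Exercise 3.7] -/
theorem numStableLinesAtThree_le_two : O5.numStableLinesAtThree W ≤ 2 := by
  by_contra hlt
  rw [not_le] at hlt
  unfold O5.numStableLinesAtThree at hlt
  obtain ⟨a, b, c, ha, hb, hc, hab, hac, hbc⟩ := Finset.two_lt_card_iff.mp hlt
  have hbc3 : (W.baseChange ℚ_[3]).Ψ₃ = (W.Ψ₃).map (algebraMap ℚ ℚ_[3]) := by
    rw [WeierstrassCurve.baseChange, map_Ψ₃]
  have hne : (W.Ψ₃).map (algebraMap ℚ ℚ_[3]) ≠ 0 := by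
    rw [← hbc3]; exact Ψ₃_ne_zero _ (by norm_num)
  have hroot : ∀ r, r ∈ ((W.Ψ₃).map (algebraMap ℚ ℚ_[3])).roots.toFinset →
      ((W.baseChange ℚ_[3]).Ψ₃).IsRoot r := fun r hr ↦ by
    rw [hbc3]; exact (mem_roots hne).mp (Multiset.mem_toFinset.mp hr)
  exact false_of_three_roots_Ψ₃ (W.baseChange ℚ_[3]) (by norm_num) (by norm_num)
    PSCoefficientField.sq_add_self_add_one_ne_zero hab hac hbc (hroot a ha) (hroot b hb) (hroot c hc)

/-- **SPLIT rows have exactly two stable lines.** [cite: Serre1972, §1.11] -/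
theorem numStableLinesAtThree_eq_two_of_shapeSplitThree (h : ShapeSplitThree W) :
    O5.numStableLinesAtThree W = 2 := by
  refine le_antisymm (numStableLinesAtThree_le_two W) ?_
  obtain ⟨r, r', hne, hr, hr'⟩ := h
  have hbc3 : (W.baseChange ℚ_[3]).Ψ₃ = (W.Ψ₃).map (algebraMap ℚ ℚ_[3]) := by
    rw [WeierstrassCurve.baseChange, map_Ψ₃]
  have hne0 : (W.Ψ₃).map (algebraMap ℚ ℚ_[3]) ≠ 0 := by
    rw [← hbc3]; exact Ψ₃_ne_zero _ (by norm_num)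
  have hmem : ∀ x, ((W.baseChange ℚ_[3]).Ψ₃).IsRoot x →
      x ∈ ((W.Ψ₃).map (algebraMap ℚ ℚ_[3])).roots.toFinset := fun x hx ↦ by
    rw [Multiset.mem_toFinset, mem_roots hne0, ← hbc3]; exact hx
  unfold O5.numStableLinesAtThree
  calc 2 = ({r, r'} : Finset ℚ_[3]).card := by rw [Finset.card_pair hne]
    _ ≤ _ := Finset.card_le_card (by
        intro x hx
        rcases Finset.mem_insert.mp hx with rfl | hx
        · exact hmem _ hr
        · rw [Finset.mem_singleton] at hx; subst hx; exact hmem _ hr')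

/-- **Two distinct roots pin the root set**: on a SPLIT row every `ℚ₃`-root of `Ψ₃` is one of the
two. [cite: Serre1972, §1.11] -/
theorem eq_or_eq_of_isRoot_of_shapeSplitThree {r r' : ℚ_[3]} (hne : r ≠ r')
    (hr : ((W.baseChange ℚ_[3]).Ψ₃).IsRoot r) (hr' : ((W.baseChange ℚ_[3]).Ψ₃).IsRoot r')
    {s : ℚ_[3]} (hs : ((W.baseChange ℚ_[3]).Ψ₃).IsRoot s) : s = r ∨ s = r' := by
  by_contra h
  push Not at h
  exact false_of_three_roots_Ψ₃ (W.baseChange ℚ_[3]) (by norm_num) (by norm_num)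
    PSCoefficientField.sq_add_self_add_one_ne_zero hne (Ne.symm h.1) (Ne.symm h.2) hr hr' hs

end Summit.BirchSwinnertonDyer.BirchSwinnertonDyer.Theorems.CompanionShape

end
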